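import Summits.CriticalPhenomena.SAWScalingLimit.Theorems.SAWDefectDecoherenceMassRatioMirrorDefs
import Summits.CriticalPhenomena.SAWScalingLimit.Theorems.SAWDefectDecoherenceBoundaryClosureRLocalL1OfSup

/-!
# Stub `stub_interiorHarnack : InteriorHarnack 0` (line `mirror-doubling-endpoint-restriction`,
crux `SAWDefectDecoherence.MassRatio`, stmt-CriticalPhenomena-8550) — status BLOCKED; reduction to one named primitive

1. NOT PROVED. `InteriorHarnack 0` asks, from the wild boundary root `a_δ`, that the point mass at
   the ONE bulk mid-edge `b_δ` of `Λ⁺ = double (Λ δ) (b δ) ⌊ρ'/δ⌋` dominate the `K`-averaged bulk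
   mass. Every route needs to MOVE THE BULK ENDPOINT of a critical SAW two-point function at bounded
   cost over `≍ 1/δ` lattice steps: a Harnack / no-cold-spot inequality for `z ↦ Z_Ω(a → z)` in the
   bulk. No such inequality is known for SAW (no FKG, no finite energy at the endpoint; one-step
   endpoint surgery costs the polygon-insertion factor `Σ_N N p_N μ^{-N}`, not known finite in 2D).
2. NOT REFUTED inside the frame: fjords must retreat into the collar of `∂D` (exhaustion of every
   compact), `B(b,ρ) ∩ D` is lattice-rigid (rows clause), so `b_δ` keeps macroscopically open access
   from every compact `K`; a slowly descending door line (`m δ` free) or a corridor-fed root only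
   multiply both sides by a common factor. A counterexample would contradict the CFT prediction
   (both sides `≍ δ^{h_b + x₁} ×` positive continuous profile).
3. SHARPEST MISSING INPUT, named below: `PointwiseInteriorHarnack 0` (sup over `K` instead of the
   `δ²`-average) — the Harnack-chain consequence of the scale-invariant bulk Harnack inequality for
   the critical SAW two-point function. PROVED here: `PointwiseInteriorHarnack s → InteriorHarnack s`
   (mid-edge counting `δ²·#{e : δ·mid e ∈ K} ≤ (14R+3)²`), monotonicity in the exponent, and the
   frame facts "eventually `0 < Z_{Λ⁺}(a_δ → b_δ)`" and "eventually `b_δ` is a bulk edge of `Λ⁺`".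
-/

noncomputable section

namespace Summit.CriticalPhenomena.SAWScalingLimit.Theorems.MassRatio.Mirror

open Literature.Probability.LatticeModels Literature.Probability.RandomPlanarGeometry
open Literature.Probability.RandomPlanarGeometry.SAW
open Summit.CriticalPhenomena.SAWScalingLimit.Theorems.MassRatio.Negative
open Summit.CriticalPhenomena.SAWScalingLimit.Theorems.MassRatio.Renewal (Z)
open Summit.CriticalPhenomena.SAWScalingLimit.Theorems.MassRatio.FlatRoot (Frame)
open Summit.CriticalPhenomena.SAWScalingLimit.Theorems.PickHalfPlane.LocalL1OfSup
  (card_mul_sq_le_of_scaled_midpoints)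
open scoped Classical Topology
open Filter

/-! ### The missing input: the pointwise (sup) interior Harnack inequality -/

/-- **POINTWISE INTERIOR HARNACK at exponent `s`** (the missing input of the stub, sup form of
`InteriorHarnack s`): in the doubled domain `Λ⁺ = double (Λ δ) (b δ) ⌊ρ'/δ⌋` of a frame, the rooted
critical two-point function at ANY mid-edge `e` with `δ·mid e` in a compact `K ⊂ Ω` is at most
`C δ^{-s}` times its value at the (bulk) mid-edge `b_δ` — "`b_δ` is no cold spot". At `s = 0` this
is the Harnack-chain form of the (open) scale-invariant bulk Harnack inequality
`Z_Ω(a → z') ≤ C₀ Z_Ω(a → z)` for `dist(z, z') ≤ R`, `Ball(z, 2R) ⊆ Ω`, of the critical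
self-avoiding walk. [folklore] -/
def PointwiseInteriorHarnack (s : ℝ) : Prop :=
  ∀ (D : DobrushinDomain) (ρ : ℝ) (Λ : ℝ → Finset HexVertex) (m : ℝ → ℤ)
    (a b : ℝ → Sym2 HexVertex), Frame D ρ Λ m a b →
    ∀ ρ' : ℝ, 0 < ρ' → ρ' ≤ rhoCap D ρ →
      ∀ K : Set ℂ, IsCompact K → K ⊆ D.carrier → ∃ C : ℝ, ∀ᶠ δ : ℝ in nhdsWithin 0 (Set.Ioi 0),
        ∀ e ∈ hexDomainMidEdges (Λ δ), (δ : ℂ) * hexMidpoint e ∈ K →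
          Z (double (Λ δ) (b δ) (scaleR ρ' δ)) (a δ) e
            ≤ C * δ ^ (-s) * Z (double (Λ δ) (b δ) (scaleR ρ' δ)) (a δ) (b δ)

/-- **Reduction of the stub to the pointwise form**: `PointwiseInteriorHarnack s → InteriorHarnack s`
(sum the pointwise bound over the at most `(14R+3)²/δ²` mid-edges with scaled midpoint in
`K ⊆ closedBall 0 R`, `0 < δ ≤ 1`). In particular the registered stub `InteriorHarnack 0` follows
from `PointwiseInteriorHarnack 0`. -/
theorem interiorHarnack_of_pointwise (s : ℝ) (h : PointwiseInteriorHarnack s) :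
    InteriorHarnack s := by
  intro D ρ Λ m a b hF ρ' hρ' hρ'c K hK hKD
  obtain ⟨C₀, hC₀⟩ := h D ρ Λ m a b hF ρ' hρ' hρ'c K hK hKD
  obtain ⟨R₀, hR₀⟩ := hK.isBounded.subset_closedBall (0 : ℂ)
  set R : ℝ := max R₀ 0 with hRdef
  have hR : 0 ≤ R := le_max_right _ _
  have hKR : K ⊆ Metric.closedBall (0 : ℂ) R :=
    hR₀.trans (Metric.closedBall_subset_closedBall (le_max_left _ _))
  refine ⟨(14 * R + 3) ^ 2 * max C₀ 0, ?_⟩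
  filter_upwards [hC₀, Ioc_mem_nhdsGT one_pos] with δ hδ hδ1
  set Λp : Finset HexVertex := double (Λ δ) (b δ) (scaleR ρ' δ) with hΛp
  set E : Set (Sym2 HexVertex) :=
    {e : Sym2 HexVertex | e ∈ hexDomainMidEdges (Λ δ) ∧ (δ : ℂ) * hexMidpoint e ∈ K} with hEdef
  have hEfin : E.Finite := (hexDomainMidEdges_finite (Λ δ)).subset fun z hz => hz.1
  show δ ^ 2 * (∑ᶠ e ∈ E, Z Λp (a δ) e) ≤
    (14 * R + 3) ^ 2 * max C₀ 0 * δ ^ (-s) * Z Λp (a δ) (b δ)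
  rw [finsum_mem_eq_finite_toFinset_sum _ hEfin]
  have hδs : 0 ≤ δ ^ (-s) := Real.rpow_nonneg hδ1.1.le _
  have hM : 0 ≤ max C₀ 0 * δ ^ (-s) * Z Λp (a δ) (b δ) :=
    mul_nonneg (mul_nonneg (le_max_right _ _) hδs) (norm_nonneg _)
  have hpt : ∀ e ∈ hEfin.toFinset, Z Λp (a δ) e ≤ max C₀ 0 * δ ^ (-s) * Z Λp (a δ) (b δ) := by
    intro e he
    obtain ⟨heΩ, heK⟩ := hEfin.mem_toFinset.1 he
    refine (hδ e heΩ heK).trans ?_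
    exact mul_le_mul_of_nonneg_right
      (mul_le_mul_of_nonneg_right (le_max_left _ _) hδs) (norm_nonneg _)
  have hsum : ∑ e ∈ hEfin.toFinset, Z Λp (a δ) e ≤
      hEfin.toFinset.card • (max C₀ 0 * δ ^ (-s) * Z Λp (a δ) (b δ)) :=
    Finset.sum_le_card_nsmul _ _ _ hpt
  rw [nsmul_eq_mul] at hsum
  have hcount : (hEfin.toFinset.card : ℝ) * δ ^ 2 ≤ (14 * R + 3) ^ 2 := by
    refine card_mul_sq_le_of_scaled_midpoints hδ1.1 hδ1.2 hR _ fun z hz => ?_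
    obtain ⟨hzΩ, hzK⟩ := hEfin.mem_toFinset.1 hz
    exact ⟨hzΩ.1, mem_closedBall_zero_iff.1 (hKR hzK)⟩
  have hδ2 : 0 ≤ δ ^ 2 := by positivity
  calc δ ^ 2 * ∑ e ∈ hEfin.toFinset, Z Λp (a δ) e
      ≤ δ ^ 2 * ((hEfin.toFinset.card : ℝ) * (max C₀ 0 * δ ^ (-s) * Z Λp (a δ) (b δ))) :=
        mul_le_mul_of_nonneg_left hsum hδ2
    _ = ((hEfin.toFinset.card : ℝ) * δ ^ 2) * (max C₀ 0 * δ ^ (-s) * Z Λp (a δ) (b δ)) := by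
        ring
    _ ≤ (14 * R + 3) ^ 2 * (max C₀ 0 * δ ^ (-s) * Z Λp (a δ) (b δ)) :=
        mul_le_mul_of_nonneg_right hcount hM
    _ = (14 * R + 3) ^ 2 * max C₀ 0 * δ ^ (-s) * Z Λp (a δ) (b δ) := by ring

/-! ### Monotonicity in the exponent -/

/-- `InteriorHarnack` is monotone in the exponent: `s ≤ s'` and `InteriorHarnack s` give
`InteriorHarnack s'` (eventually `δ ≤ 1`, so `δ^{-s} ≤ δ^{-s'}`; the constant is made `≥ 0`). -/
theorem interiorHarnack_mono {s s' : ℝ} (hss' : s ≤ s') (h : InteriorHarnack s) :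
    InteriorHarnack s' := by
  intro D ρ Λ m a b hF ρ' hρ' hρ'c K hK hKD
  obtain ⟨C, hC⟩ := h D ρ Λ m a b hF ρ' hρ' hρ'c K hK hKD
  refine ⟨max C 0, ?_⟩
  filter_upwards [hC, Ioc_mem_nhdsGT one_pos] with δ hδ hδ1
  have hZ : 0 ≤ Z (double (Λ δ) (b δ) (scaleR ρ' δ)) (a δ) (b δ) := norm_nonneg _
  have hδs : 0 ≤ δ ^ (-s) := Real.rpow_nonneg hδ1.1.le _
  have hpow : δ ^ (-s) ≤ δ ^ (-s') :=
    Real.rpow_le_rpow_of_exponent_ge hδ1.1 hδ1.2 (neg_le_neg hss')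
  calc _ ≤ C * δ ^ (-s) * Z (double (Λ δ) (b δ) (scaleR ρ' δ)) (a δ) (b δ) := hδ
    _ ≤ max C 0 * δ ^ (-s) * Z (double (Λ δ) (b δ) (scaleR ρ' δ)) (a δ) (b δ) :=
        mul_le_mul_of_nonneg_right (mul_le_mul_of_nonneg_right (le_max_left _ _) hδs) hZ
    _ ≤ max C 0 * δ ^ (-s') * Z (double (Λ δ) (b δ) (scaleR ρ' δ)) (a δ) (b δ) :=
        mul_le_mul_of_nonneg_right (mul_le_mul_of_nonneg_left hpow (le_max_right _ _)) hZ

/-- Hence the stub at exponent `0` gives every nonnegative exponent. -/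
theorem interiorHarnack_of_zero {s : ℝ} (hs : 0 ≤ s) (h : InteriorHarnack 0) : InteriorHarnack s :=
  interiorHarnack_mono hs h

/-! ### Frame facts about the doubled domain -/

/-- `Z_{Λ_δ} ≤ Z_{Λ⁺}`: the doubling only adds walks (domain monotonicity). -/
theorem Z_le_Z_double (Λ : Finset HexVertex) (b : Sym2 HexVertex) (R : ℝ) (r z : Sym2 HexVertex) :
    Z Λ r z ≤ Z (double Λ b R) r z :=
  FlatRoot.domainMono _ _ _ _ (subset_double Λ b R)

/-- In the frame the right-hand side of `InteriorHarnack` is eventually POSITIVE: the admissible SAW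
`a_δ → b_δ` of `Λ_δ` is a walk of `Λ⁺`, of weight `x_c^{ℓ} > 0`. -/
theorem frame_eventually_pos {D : DobrushinDomain} {ρ : ℝ} {Λ : ℝ → Finset HexVertex} {m : ℝ → ℤ}
    {a b : ℝ → Sym2 HexVertex} (hF : Frame D ρ Λ m a b) (ρ' : ℝ) :
    ∀ᶠ δ : ℝ in nhdsWithin 0 (Set.Ioi 0),
      0 < Z (double (Λ δ) (b δ) (scaleR ρ' δ)) (a δ) (b δ) := by
  obtain ⟨-, -, hadm, -, -, -⟩ := hF
  filter_upwards [hadm] with δ hδ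
  obtain ⟨-, -, -, ⟨γ⟩, -⟩ := hδ
  have hx := hexCriticalFugacity_pos_lt_one.1
  calc (0 : ℝ) < hexCriticalFugacity ^ γ.length := pow_pos hx _
    _ ≤ Z (Λ δ) (a δ) (b δ) := pow_length_le_norm_Z _ _ _ γ hx.le
    _ ≤ Z (double (Λ δ) (b δ) (scaleR ρ' δ)) (a δ) (b δ) := Z_le_Z_double _ _ _ _ _

/-- `⌊ρ'/δ⌋ ≥ 1` once `0 < δ ≤ ρ'`. -/
theorem one_le_scaleR {ρ' δ : ℝ} (hδ : 0 < δ) (hδρ : δ ≤ ρ') : 1 ≤ scaleR ρ' δ := by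
  unfold scaleR
  have h1 : (1 : ℝ) ≤ ρ' / δ := by rw [le_div_iff₀ hδ, one_mul]; exact hδρ
  exact Nat.le_floor (by exact_mod_cast h1)

/-- Adjacent vertices of `ℍ` have centres at distance `< 2` (brick coordinates; the true value is
`1/√3`). -/
theorem norm_hexCenter_sub_lt_two {u v : HexVertex} (h : hexGraph.Adj u v) :
    ‖hexCenter u - hexCenter v‖ < 2 := by
  have hre : |(hexCenter u - hexCenter v).re| ≤ 1 / 2 := by
    rw [Complex.sub_re, hexCenter_re, hexCenter_re, abs_le]
    rw [adj_iff] at h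
    rcases h with ⟨-, hp | hp⟩ | ⟨hp, -, -⟩ | ⟨hp, -, -⟩
    · rw [hp]; push_cast; constructor <;> linarith
    · rw [hp]; push_cast; constructor <;> linarith
    · rw [hp]; constructor <;> linarith
    · rw [hp]; constructor <;> linarith
  have hrow : |((row u : ℝ)) - row v| ≤ 1 := by
    rw [abs_le]
    rw [adj_iff] at h
    rcases h with ⟨hr, -⟩ | ⟨-, hr, -⟩ | ⟨-, hr, -⟩
    · rw [hr]; constructor <;> linarith
    · rw [hr]; push_cast; constructor <;> linarith
    · rw [hr]; push_cast; constructor <;> linarith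
  have him : |(hexCenter u - hexCenter v).im| ≤ 7 / 6 := by
    have hu1 := hexCenter_im_ge u
    have hu2 := hexCenter_im_le u
    have hv1 := hexCenter_im_ge v
    have hv2 := hexCenter_im_le v
    set t : ℝ := Real.sqrt 3 / 2 with ht
    have ht0 : 0 < t := by positivity
    have ht1 : t < 7 / 8 := by rw [ht]; linarith [sqrt3_lt]
    rw [abs_le] at hrow
    have hd1 : t * (((row u : ℝ)) - row v) ≤ t := by
      have := mul_le_mul_of_nonneg_left hrow.2 ht0.le; simpa using this
    have hd2 : -t ≤ t * (((row u : ℝ)) - row v) := by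
      have := mul_le_mul_of_nonneg_left hrow.1 ht0.le; simpa using this
    rw [Complex.sub_im, abs_le]
    constructor <;> nlinarith
  calc ‖hexCenter u - hexCenter v‖
      ≤ |(hexCenter u - hexCenter v).re| + |(hexCenter u - hexCenter v).im| :=
        Complex.norm_le_abs_re_add_abs_im _
    _ < 2 := by linarith

/-- An endpoint of an edge of `ℍ` lies at distance `< 1` from its midpoint. -/
theorem dist_hexCenter_hexMidpoint_lt_one {u v : HexVertex} (h : hexGraph.Adj u v) :
    dist (hexCenter u) (hexMidpoint s(u, v)) < 1 := by
  rw [Complex.dist_eq, hexMidpoint_mk]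
  have : hexCenter u - (hexCenter u + hexCenter v) / 2 = (hexCenter u - hexCenter v) / 2 := by ring
  rw [this, norm_div, Complex.norm_two]
  linarith [norm_hexCenter_sub_lt_two h]

/-- In the frame, `b_δ` is eventually a BULK mid-edge of the doubled domain: both its endpoints lie
in `Λ⁺ = double (Λ δ) (b δ) ⌊ρ'/δ⌋` (the inner one in `Λ_δ`, the outer one in the phantom ball,
as soon as `δ ≤ ρ'`). -/
theorem frame_eventually_bulk {D : DobrushinDomain} {ρ : ℝ} {Λ : ℝ → Finset HexVertex} {m : ℝ → ℤ}
    {a b : ℝ → Sym2 HexVertex} (hF : Frame D ρ Λ m a b) {ρ' : ℝ} (hρ' : 0 < ρ') :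
    ∀ᶠ δ : ℝ in nhdsWithin 0 (Set.Ioi 0), ∀ v ∈ b δ, v ∈ double (Λ δ) (b δ) (scaleR ρ' δ) := by
  obtain ⟨-, -, hadm, -, -, -⟩ := hF
  filter_upwards [hadm, Ioc_mem_nhdsGT hρ'] with δ hδ hδI
  obtain ⟨-, -, hb, -⟩ := hδ
  obtain ⟨he, u, w, hbe, hw, -⟩ := hb
  have hR : (1 : ℝ) ≤ (scaleR ρ' δ : ℝ) := by exact_mod_cast one_le_scaleR hδI.1 hδI.2
  have hadj : hexGraph.Adj u w := by rw [hbe] at he; exact he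
  intro v hv
  rw [hbe] at hv ⊢
  rcases Sym2.mem_iff.1 hv with rfl | rfl
  · rw [double, Finset.mem_union]
    right
    rw [mem_ball]
    exact (dist_hexCenter_hexMidpoint_lt_one hadj).trans_le hR
  · exact subset_double _ _ _ hw

/-- The stub is therefore EQUIVALENT to its version with a nonnegative constant and `δ ≤ 1`; recorded
as the normal form the glue consumes: eventually `δ² Σ_K Z_{Λ⁺}(a_δ → e) ≤ C · Z_{Λ⁺}(a_δ → b_δ)`
with `0 ≤ C` (at `s = 0` the factor `δ^{-0}` is `1`). -/
theorem interiorHarnack_zero_iff :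
    InteriorHarnack 0 ↔
      ∀ (D : DobrushinDomain) (ρ : ℝ) (Λ : ℝ → Finset HexVertex) (m : ℝ → ℤ)
        (a b : ℝ → Sym2 HexVertex), Frame D ρ Λ m a b →
        ∀ ρ' : ℝ, 0 < ρ' → ρ' ≤ rhoCap D ρ →
          ∀ K : Set ℂ, IsCompact K → K ⊆ D.carrier → ∃ C : ℝ, 0 ≤ C ∧
            ∀ᶠ δ : ℝ in nhdsWithin 0 (Set.Ioi 0),
              δ ^ 2 * (∑ᶠ e ∈ {e : Sym2 HexVertex | e ∈ hexDomainMidEdges (Λ δ) ∧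
                  (δ : ℂ) * hexMidpoint e ∈ K}, Z (double (Λ δ) (b δ) (scaleR ρ' δ)) (a δ) e)
                ≤ C * Z (double (Λ δ) (b δ) (scaleR ρ' δ)) (a δ) (b δ) := by
  constructor
  · intro h D ρ Λ m a b hF ρ' hρ' hρ'c K hK hKD
    obtain ⟨C, hC⟩ := h D ρ Λ m a b hF ρ' hρ' hρ'c K hK hKD
    refine ⟨max C 0, le_max_right _ _, ?_⟩
    filter_upwards [hC] with δ hδ
    rw [neg_zero, Real.rpow_zero, mul_one] at hδ
    exact hδ.trans (mul_le_mul_of_nonneg_right (le_max_left _ _) (norm_nonneg _))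
  · intro h D ρ Λ m a b hF ρ' hρ' hρ'c K hK hKD
    obtain ⟨C, -, hC⟩ := h D ρ Λ m a b hF ρ' hρ' hρ'c K hK hKD
    refine ⟨C, ?_⟩
    filter_upwards [hC] with δ hδ
    rwa [neg_zero, Real.rpow_zero, mul_one]

/-- **Registered sub-goal (verbatim form): the pointwise (sup) interior Harnack inequality implies the
line's stub `stub_interiorHarnack` (take `s = 0`), at every exponent `s`.** -/
theorem interiorHarnack_of_pointwiseInteriorHarnack : ∀ s : ℝ, PointwiseInteriorHarnack s → InteriorHarnack s :=
  fun s h => interiorHarnack_of_pointwise s h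

end Summit.CriticalPhenomena.SAWScalingLimit.Theorems.MassRatio.Mirror
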